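import Mathlib
import Summits.Ventures.PercRepro2.SwOutMixedBaseDefs
import Summits.Ventures.PercRepro2.SwOutMixedArmsDefs

/-!
# The several-arms base: vocabulary and the realisation of the raw cube (blind cell PercRepro2,
night-4 g20, 2026-08-27; proofs/NIGHT4-G20.md §4′)

The geometric side of the several-arms big-block lemma (`MixedArms.mixedArms_card_le`): a
`MixedBaseR` is a base configuration `σ` around `h`, the junction `u` and the dropped vertices
`p r` of the arms `r : ρ`, with the u-ARMS `U j` (each joined to `u`, each red-connected to `h`
inside itself), the PIECES `Ah i` (`i : ν`, the piece `i` belonging to the arm `arm i`; each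
red-connected to `h` inside itself, joined to `p (arm i)` by the DEAD edges, not joined to `u`),
and the FAR arms `F k`; at `σ` every edge at `h` and at `u` is red, the dead edges and the outside
edges of every `p r` are blue, and every edge from an arm to the outside is blue.  An arm without
pieces is a PURE arm: a single vertex joined to `u`.  The EDGE CLASSES are the edges touching
`U j`, touching `Ah i` (the dead edges included), the u–`p r` edges, the outside edges of `p r`
and the edges touching `F k`; a point `q = (s, a, uP, e, f)` of the raw cube `PtR ι ρ ν κ` is
realised by flipping the classes whose coordinate is `false` (`mixedRealR`).  This file: the
classes, the realisation, the structure and its first consequences (no loops; which vertices an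
edge at `h`, `u` or `p r` can join).  The single-arm case `ρ = Unit` is `BigBlock.MixedBase`
(`SwOutMixedBaseDefs`), whose field names are kept.
-/

namespace Summit.Ventures.PercRepro2

namespace MixedArms

open Hull LocRows

variable {V : Type*} {E : Type*}

open scoped Classical

variable (ends : E → Sym2 V)

section Classes

variable (h u : V) {ι ρ ν κ : Type*} (U : ι → Set V) (p : ρ → V) (Ah : ν → Set V) (F : κ → Set V)

/-- The union of all arms. -/
def armsAllR : Set V := (⋃ j, U j) ∪ (⋃ i, Ah i) ∪ ⋃ k, F k

/-- The u–`p r` edges. -/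
def clsUPR (r : ρ) : Set E := {e | ends e = s(u, p r)}

/-- The outside edges of `p r`: the edges at `p r` not going to `u` or into a piece. -/
def clsExtR (r : ρ) : Set E := {e | ∃ x, ends e = s(p r, x) ∧ x ≠ u ∧ ∀ i, x ∉ Ah i}

/-- The edges flipped by a point of the raw cube: the classes with coordinate `false`. -/
def flipSetR (q : PtR ι ρ ν κ) : Set E :=
  {e | ∃ j, q.1 j = false ∧ e ∈ touches ends (U j)} ∪
    {e | ∃ i, q.2.1 i = false ∧ e ∈ touches ends (Ah i)} ∪
    {e | ∃ r, q.2.2.1 r = false ∧ e ∈ clsUPR ends u p r} ∪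
    {e | ∃ r, q.2.2.2.1 r = false ∧ e ∈ clsExtR ends u p Ah r} ∪
    {e | ∃ k, q.2.2.2.2 k = false ∧ e ∈ touches ends (F k)}

/-- The realisation of a point of the raw cube: the base with the flipped classes. -/
noncomputable def mixedRealR (σ : Config E) (q : PtR ι ρ ν κ) : Config E :=
  fun e => if e ∈ flipSetR ends u U p Ah F q then !σ e else σ e

end Classes

/-- **The data of a several-arms base** (see the module docstring). -/
structure MixedBaseR (ends : E → Sym2 V) (σ : Config E) (h u : V) {ι ρ ν κ : Type*}
    (U : ι → Set V) (p : ρ → V) (Ah : ν → Set V) (arm : ν → ρ) (F : κ → Set V) : Prop where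
  hne_hu : h ≠ u
  hne_hp : ∀ r, h ≠ p r
  hne_up : ∀ r, u ≠ p r
  p_inj : Function.Injective p
  h_notMem_U : ∀ j, h ∉ U j
  u_notMem_U : ∀ j, u ∉ U j
  p_notMem_U : ∀ r j, p r ∉ U j
  h_notMem_Ah : ∀ i, h ∉ Ah i
  u_notMem_Ah : ∀ i, u ∉ Ah i
  p_notMem_Ah : ∀ r i, p r ∉ Ah i
  h_notMem_F : ∀ k, h ∉ F k
  u_notMem_F : ∀ k, u ∉ F k
  p_notMem_F : ∀ r k, p r ∉ F k
  U_disj : ∀ j j', j ≠ j' → ∀ x, x ∈ U j → x ∉ U j'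
  U_disj_Ah : ∀ j i x, x ∈ U j → x ∉ Ah i
  U_disj_F : ∀ j k x, x ∈ U j → x ∉ F k
  Ah_disj : ∀ i i', i ≠ i' → ∀ x, x ∈ Ah i → x ∉ Ah i'
  Ah_disj_F : ∀ i k x, x ∈ Ah i → x ∉ F k
  F_disj : ∀ k k', k ≠ k' → ∀ x, x ∈ F k → x ∉ F k'
  U_nonempty : ∀ j, (U j).Nonempty
  Ah_nonempty : ∀ i, (Ah i).Nonempty
  F_nonempty : ∀ k, (F k).Nonempty
  no_cross_UU : ∀ j j', j ≠ j' → ∀ e x y, ends e = s(x, y) → x ∈ U j → y ∈ U j' → False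
  no_cross_UAh : ∀ j i e x y, ends e = s(x, y) → x ∈ U j → y ∈ Ah i → False
  no_cross_UF : ∀ j k e x y, ends e = s(x, y) → x ∈ U j → y ∈ F k → False
  no_cross_AhAh : ∀ i i', i ≠ i' → ∀ e x y, ends e = s(x, y) → x ∈ Ah i → y ∈ Ah i' → False
  no_cross_AhF : ∀ i k e x y, ends e = s(x, y) → x ∈ Ah i → y ∈ F k → False
  no_cross_FF : ∀ k k', k ≠ k' → ∀ e x y, ends e = s(x, y) → x ∈ F k → y ∈ F k' → False
  h_edges : ∀ e x, ends e = s(h, x) → (∃ j, x ∈ U j) ∨ (∃ i, x ∈ Ah i) ∨ ∃ k, x ∈ F k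
  u_edges : ∀ e x, ends e = s(u, x) → (∃ j, x ∈ U j) ∨ ∃ r, x = p r
  p_edges : ∀ r e x, ends e = s(p r, x) →
    x = u ∨ (∃ i, arm i = r ∧ x ∈ Ah i) ∨
      (x ≠ h ∧ (∀ r', x ≠ p r') ∧ x ∉ armsAllR U Ah F)
  u_adj_U : ∀ j, ∃ e x, ends e = s(u, x) ∧ x ∈ U j
  h_red : ∀ e x, ends e = s(h, x) → σ e = true
  u_red : ∀ e x, ends e = s(u, x) → σ e = true
  dead_blue : ∀ r e x, ends e = s(p r, x) → (∃ i, x ∈ Ah i) → σ e = false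
  ext_blue : ∀ r e x, ends e = s(p r, x) → x ≠ u → (∀ i, x ∉ Ah i) → σ e = false
  bdry_blue : ∀ e x y, ends e = s(x, y) → x ∈ armsAllR U Ah F → y ≠ h → y ≠ u → (∀ r, y ≠ p r) →
    y ∉ armsAllR U Ah F → σ e = false
  U_conn : ∀ j, ∀ x ∈ U j, x ∈ cluster ends (insideConfig ends (U j ∪ {h}) σ) h
  Ah_conn : ∀ i, ∀ x ∈ Ah i, x ∈ cluster ends (insideConfig ends (Ah i ∪ {h}) σ) h
  F_conn : ∀ k, ∀ x ∈ F k, x ∈ cluster ends (insideConfig ends (F k ∪ {h}) σ) h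

section Base

variable {ends} {σ : Config E} {h u : V} {ι ρ ν κ : Type*} {U : ι → Set V} {p : ρ → V}
  {Ah : ν → Set V} {arm : ν → ρ} {F : κ → Set V} (hb : MixedBaseR ends σ h u U p Ah arm F)
include hb

/-- No loop at `h`. -/
lemma MixedBaseR.loop_h (e : E) : ends e ≠ s(h, h) := by
  intro he
  rcases hb.h_edges e h he with ⟨j, hj⟩ | ⟨i, hi⟩ | ⟨k, hk⟩
  · exact hb.h_notMem_U j hj
  · exact hb.h_notMem_Ah i hi
  · exact hb.h_notMem_F k hk

/-- No loop at `u`. -/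
lemma MixedBaseR.loop_u (e : E) : ends e ≠ s(u, u) := by
  intro he
  rcases hb.u_edges e u he with ⟨j, hj⟩ | ⟨r, hr⟩
  · exact hb.u_notMem_U j hj
  · exact hb.hne_up r hr

/-- No loop at a dropped vertex. -/
lemma MixedBaseR.loop_p (r : ρ) (e : E) : ends e ≠ s(p r, p r) := by
  intro he
  rcases hb.p_edges r e (p r) he with hj | ⟨i, -, hi⟩ | ⟨-, hj, -⟩
  · exact hb.hne_up r hj.symm
  · exact hb.p_notMem_Ah r i hi
  · exact hj r rfl

/-- No edge joins `h` and `u`. -/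
lemma MixedBaseR.no_hu (e : E) : ends e ≠ s(h, u) := by
  intro he
  rcases hb.h_edges e u he with ⟨j, hj⟩ | ⟨i, hi⟩ | ⟨k, hk⟩
  · exact hb.u_notMem_U j hj
  · exact hb.u_notMem_Ah i hi
  · exact hb.u_notMem_F k hk

/-- No edge joins `h` and a dropped vertex. -/
lemma MixedBaseR.no_hp (r : ρ) (e : E) : ends e ≠ s(h, p r) := by
  intro he
  rcases hb.h_edges e (p r) he with ⟨j, hj⟩ | ⟨i, hi⟩ | ⟨k, hk⟩
  · exact hb.p_notMem_U r j hj
  · exact hb.p_notMem_Ah r i hi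
  · exact hb.p_notMem_F r k hk

/-- No edge joins two dropped vertices. -/
lemma MixedBaseR.no_pp (r r' : ρ) (e : E) : ends e ≠ s(p r, p r') := by
  intro he
  rcases hb.p_edges r e (p r') he with hj | ⟨i, -, hi⟩ | ⟨-, hj, -⟩
  · exact hb.hne_up r' hj.symm
  · exact hb.p_notMem_Ah r' i hi
  · exact hj r' rfl

/-- A dead edge of a dropped vertex goes to a piece of its own arm. -/
lemma MixedBaseR.arm_of_dead {r : ρ} {e : E} {x : V} (he : ends e = s(p r, x)) {i : ν}
    (hx : x ∈ Ah i) : arm i = r := by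
  rcases hb.p_edges r e x he with hj | ⟨i', hi', hx'⟩ | ⟨-, -, hj⟩
  · rw [hj] at hx
    exact absurd hx (hb.u_notMem_Ah i)
  · by_cases hii : i = i'
    · rw [hii]
      exact hi'
    · exact absurd hx' (hb.Ah_disj i i' hii x hx)
  · exact absurd (Set.mem_union_left _ (Set.mem_union_right _ (Set.mem_iUnion.2 ⟨i, hx⟩))) hj

omit hb in
/-- A dead edge lies in the class of its piece. -/
lemma MixedBaseR.dead_mem_touches {r : ρ} {e : E} {x : V} (he : ends e = s(p r, x)) {i : ν}
    (hx : x ∈ Ah i) : e ∈ touches ends (Ah i) := by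
  refine ⟨x, hx, ?_⟩
  rw [he]
  exact Sym2.mem_mk_right _ _

end Base

section OfMixedBase

variable {ends : E → Sym2 V} {σ : Config E} {h u p : V} {ι κ : Type*} {U : ι → Set V} {Ah : Set V}
  {F : κ → Set V}

/-- A single-arm mixed base (`BigBlock.MixedBase`) is a several-arms base with one arm and one
piece. -/
theorem MixedBaseR.ofMixedBase (hb : BigBlock.MixedBase ends σ h u p U Ah F) :
    MixedBaseR ends σ h u U (fun _ : Unit => p) (fun _ : Unit => Ah) (fun _ => ()) F where
  hne_hu := hb.hne_hu
  hne_hp := fun _ => hb.hne_hp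
  hne_up := fun _ => hb.hne_up
  p_inj := fun _ _ _ => rfl
  h_notMem_U := hb.h_notMem_U
  u_notMem_U := hb.u_notMem_U
  p_notMem_U := fun _ => hb.p_notMem_U
  h_notMem_Ah := fun _ => hb.h_notMem_Ah
  u_notMem_Ah := fun _ => hb.u_notMem_Ah
  p_notMem_Ah := fun _ _ => hb.p_notMem_Ah
  h_notMem_F := hb.h_notMem_F
  u_notMem_F := hb.u_notMem_F
  p_notMem_F := fun _ => hb.p_notMem_F
  U_disj := hb.U_disj
  U_disj_Ah := fun j _ => hb.U_disj_Ah j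
  U_disj_F := hb.U_disj_F
  Ah_disj := fun _ _ hne => absurd rfl hne
  Ah_disj_F := fun _ => hb.Ah_disj_F
  F_disj := hb.F_disj
  U_nonempty := hb.U_nonempty
  Ah_nonempty := fun _ => hb.Ah_nonempty
  F_nonempty := hb.F_nonempty
  no_cross_UU := hb.no_cross_UU
  no_cross_UAh := fun j _ => hb.no_cross_UAh j
  no_cross_UF := hb.no_cross_UF
  no_cross_AhAh := fun _ _ hne => absurd rfl hne
  no_cross_AhF := fun _ => hb.no_cross_AhF
  no_cross_FF := hb.no_cross_FF
  h_edges := fun e x he => by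
    rcases hb.h_edges e x he with h | h | h
    · exact Or.inl h
    · exact Or.inr (Or.inl ⟨(), h⟩)
    · exact Or.inr (Or.inr h)
  u_edges := fun e x he => by
    rcases hb.u_edges e x he with h | h
    · exact Or.inl h
    · exact Or.inr ⟨(), h⟩
  p_edges := fun _ e x he => by
    rcases hb.p_edges e x he with h | h | ⟨h1, h2, h3⟩
    · exact Or.inl h
    · exact Or.inr (Or.inl ⟨(), rfl, h⟩)
    · refine Or.inr (Or.inr ⟨h1, fun _ => h2, fun hx => h3 ?_⟩)
      rcases hx with (hx | hx) | hx
      · exact Or.inl (Or.inl hx)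
      · obtain ⟨_, hx'⟩ := Set.mem_iUnion.1 hx
        exact Or.inl (Or.inr hx')
      · exact Or.inr hx
  u_adj_U := hb.u_adj_U
  h_red := hb.h_red
  u_red := hb.u_red
  dead_blue := fun _ e x he hx => hb.dead_blue e x he (hx.elim fun _ h => h)
  ext_blue := fun _ e x he hu hA => hb.ext_blue e x he hu (hA ())
  bdry_blue := fun e x y he hx hyh hyu hyp hy => hb.bdry_blue e x y he (by
      rcases hx with (hx | hx) | hx
      · exact Or.inl (Or.inl hx)
      · obtain ⟨_, hx'⟩ := Set.mem_iUnion.1 hx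
        exact Or.inl (Or.inr hx')
      · exact Or.inr hx) hyh hyu (hyp ()) (fun hy' => hy (by
      rcases hy' with (hy' | hy') | hy'
      · exact Or.inl (Or.inl hy')
      · exact Or.inl (Or.inr (Set.mem_iUnion.2 ⟨(), hy'⟩))
      · exact Or.inr hy'))
  U_conn := hb.U_conn
  Ah_conn := fun _ => hb.Ah_conn
  F_conn := hb.F_conn

end OfMixedBase

end MixedArms

end Summit.Ventures.PercRepro2
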